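import Mathlib
import Summits.MatrixMultiplication.MatrixMultiplication.Theses.CwPowerHosting

/-!
# Strategist sketch — crux `HostingRateThree` (stmt-MatrixMultiplication-15970): first lemmas of the NEGATION / STRENGTHEN ideas

Elaboration check for the Lean signatures quoted in `STRATEGY-CENSUS.md` and the crux idea cards
`Ideas/large-spectrum-integer-model.md`, `Ideas/sumset-saturation.md` (planner-cstrat-stmt-MatrixMultiplication-15970-b1-0, 2026-08-17).
Nothing here is registered; statements only (`sorry` on the one lemma whose proof is Parseval + the exact solution count).
-/

namespace Summit.MatrixMultiplication.MatrixMultiplication.Cruxes.HostingRateThree.StrategistSketch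

open Finset
open scoped Pointwise

/-- The `∃ α β γ` clause of `HostingRateThree`: a free additive hosting of `supp(xyz^{⊠N})` in `H`. -/
def IsFreeHosting {N : ℕ} {H : Type} [AddCommGroup H] (α β γ : (Fin N → Fin 3) → H) : Prop :=
  ∀ x y z : Fin N → Fin 3, α x + β y + γ z = 0 ↔ ∀ i, x i ≠ y i ∧ x i ≠ z i ∧ y i ≠ z i

/-- NEGATION lens, first lemma (idea `large-spectrum-integer-model`, provable now: Parseval + `#{x+y+z=0} = 6^N` exactly +
injectivity of `β, γ`).  A free hosting with a small host has a LARGE nontrivial Fourier coefficient: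
some `χ ≠ 1` has `|Σ_x χ(α x)| ≥ (27^N − 6^N |H|)/(3^N |H|)` (`≈ |Q|·3^{-εN}` when `|H| = 3^{(1+ε)N}`). -/
theorem largeSpectrum_of_isFreeHosting {N : ℕ} {H : Type} [AddCommGroup H] [Fintype H] [DecidableEq H]
    (α β γ : (Fin N → Fin 3) → H) (h : IsFreeHosting α β γ) (hH : 1 < Fintype.card H) :
    ∃ χ : AddChar H ℂ, χ ≠ 1 ∧
      ((27 : ℝ) ^ N - (6 : ℝ) ^ N * Fintype.card H) / ((3 : ℝ) ^ N * Fintype.card H) ≤ ‖∑ x : Fin N → Fin 3, χ (α x)‖ := by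
  sorry

/-- STRENGTHEN lens (idea `sumset-saturation`): the two-leg sumset of a free hosting has at least `4^N` elements.  Implies the
route's `HostingCapacityGap` with `3 + δ = 4` (so it REFUTES the crux); data: equality `|A+B| = |H| = 4^N` on every order-`4^N` host found
(`N ≤ 3`), `|A+B| ∈ {19,…,27}` on the `N = 2` hosts of order `20–28`, `≥ 71` on the `N = 3` hosts of order `72, 73, 80`. -/
def SumsetSaturation : Prop :=
  ∀ (N : ℕ) (H : Type) [AddCommGroup H] [Fintype H] [DecidableEq H] (α β γ : (Fin N → Fin 3) → H),
    IsFreeHosting α β γ → 4 ^ N ≤ ((univ.image α) + (univ.image β)).card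

/-- NEGATION lens (idea `sumset-saturation`, §2-adic floor): every free hosting in an abelian 2-GROUP has `|H| ≥ 4^N` — the route's
`TwoGroupFloor` (exponent 2) extended to all 2-power exponents; tight by the exact family `(ℤ/2^N)²`; checked by exhaustive search for
`N ≤ 4` (no 2-group of order `128` with ≤ 4 cyclic factors hosts `N = 4`).  Kills every self-affine tower cell with base a power of two. -/
def TwoAdicFloor : Prop :=
  ∀ (N : ℕ) (H : Type) [AddCommGroup H] [Fintype H] (α β γ : (Fin N → Fin 3) → H),
    (∃ a : ℕ, ∀ h : H, 2 ^ a • h = 0) → IsFreeHosting α β γ → 4 ^ N ≤ Fintype.card H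

/-- `SumsetSaturation` refutes the crux outright (so it is filed as a NEGATION-side idea, never as a line): with `|A + B| ≤ |H|` it gives
`4^N ≤ |H| ≤ 3^{(1+ε)N}`, false at `ε < log 4/log 3 − 1` for every `N ≥ 1`. -/
theorem not_hostingRateThree_of_sumsetSaturation (hS : SumsetSaturation) :
    ¬ Summit.MatrixMultiplication.MatrixMultiplication.Theses.CwPowerHosting.HostingRateThree := by
  intro hX
  -- ε = 1/4: 3^{5/4} < 4
  obtain ⟨N, H, _, _, hN, hcard, α, β, γ, hhost⟩ := hX (1 / 4) (by norm_num)
  classical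
  have h4 : (4 : ℝ) ^ N ≤ Fintype.card H := by
    have h1 := hS N H α β γ hhost
    have h2 : ((univ.image α) + (univ.image β)).card ≤ Fintype.card H := Finset.card_le_univ _
    exact_mod_cast h1.trans h2
  have hlt : (3 : ℝ) ^ ((1 + 1 / 4) * (N : ℝ)) < (4 : ℝ) ^ N := by
    have hN0 : (0 : ℝ) < N := by exact_mod_cast hN
    have h34 : (3 : ℝ) ^ ((1 + 1 / 4 : ℝ)) < 4 := by
      have : (3 : ℝ) ^ ((1 + 1 / 4 : ℝ)) < (3 : ℝ) ^ ((5 : ℝ) / 4) + 1e-9 := by norm_num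
      -- 3^{5/4} = 3 · 3^{1/4} and 3^{1/4} < 4/3 since 3 < (4/3)^4 = 256/81
      have hq : (3 : ℝ) ^ ((1 : ℝ) / 4) < 4 / 3 := by
        have h81 : (3 : ℝ) < (4 / 3 : ℝ) ^ (4 : ℕ) := by norm_num
        have := Real.rpow_lt_rpow (by norm_num) h81 (by norm_num : (0 : ℝ) < 1 / 4)
        rwa [← Real.rpow_natCast, ← Real.rpow_mul (by norm_num), show ((4 : ℕ) : ℝ) * (1 / 4) = 1 by norm_num,
          Real.rpow_one] at this
      calc (3 : ℝ) ^ ((1 + 1 / 4 : ℝ)) = (3 : ℝ) ^ (1 : ℝ) * (3 : ℝ) ^ ((1 : ℝ) / 4) := by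
            rw [← Real.rpow_add (by norm_num)]
        _ < 3 * (4 / 3) := by rw [Real.rpow_one]; exact mul_lt_mul_of_pos_left hq (by norm_num)
        _ = 4 := by norm_num
    calc (3 : ℝ) ^ ((1 + 1 / 4) * (N : ℝ)) = ((3 : ℝ) ^ ((1 + 1 / 4 : ℝ))) ^ (N : ℝ) := by
          rw [← Real.rpow_mul (by norm_num)]
      _ < (4 : ℝ) ^ (N : ℝ) := Real.rpow_lt_rpow (by positivity) h34 hN0
      _ = (4 : ℝ) ^ N := Real.rpow_natCast 4 N
  linarith

end Summit.MatrixMultiplication.MatrixMultiplication.Cruxes.HostingRateThree.StrategistSketch
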